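import Summits.QuantumAdvantage.QuantumAdvantage.Theorems.ArithStatLadderAcZeroRungSubcubeTransferLemmas

/-!
# Stub `stub_subcubeTransfer` — from the cube to weighted class sub-cubes

Crux `ArithStatLadder.AcZeroRung` (stmt-QuantumAdvantage-2425), line `dyadic-chirp-poisson`,
registered stub `stub_subcubeTransfer` (S3) of the lead's checked skeleton.

RUNNING LOG. done: full proof, rc 0 (checked together with the helper file
`ArithStatLadderAcZeroRungSubcubeTransferLemmas.lean`: coordinates, projection data, numerics).
next: land.

## Statement

Braverman's theorem (shape: polylog-wise independence fools `AC⁰`, hypothesis 1) and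
Alon–Goldreich–Mansour (almost `K`-wise independent ⇒ `L¹`-close to exactly `K`-wise independent,
hypothesis 2) imply: for depth `k`, size `p`, accuracy `ε` there is `A` such that for all large
`n`, every NONNEGATIVE weight `w` on the class sub-cube
`Q_{n,r} = {2^{n-1} ≤ d < 2^n : d ≡ r (mod 16)}` of mass `≤ N` whose Walsh sums on nonempty sets of
`≤ (log₂ n)^A` free bit positions (`4 ≤ i ≤ n-2`) are `≤ 2^{-(log₂ n)^{A+2}} N` satisfies
`|Σ_Q w·sgn C − (Σ_Q w)·avg_Q sgn C| ≤ ε N` for every `acBasis`-circuit `C` of `acDepth ≤ k` and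
size `≤ p(n)`.

## Proof outline (pure plumbing)

* The case `W = Σ_Q w = 0` is trivial (`w = 0` on `Q`). Otherwise `r < 16`, and
  `Q_{n,r} ≅ {0,1}^{n-5}` via the free bits (`SubcubeTransfer.exists_coords`: all `Q`-sums are
  cube sums, `#Q = 2^{n-5}`).
* PROJECTION: hard-wire the five fixed inputs of `C` (`Circuit.exists_project`, proved in the
  tree): a circuit `D` on `n-5` inputs over `acBasis`, `size ≤ max size 1`,
  `acDepth ≤ max acDepth 1`, with `D(z) = C(bits (enc z))`.
* MEASURE: `ν z = w(enc z)/W` (`exists_pmf`); its Walsh biases on nonempty `T`,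
  `|T| ≤ K = (log₂ n)^A`, are the hypothesis' Walsh sums on the shifted free positions `T + 4`
  (`exists_shift`), hence `≤ βN/W`, `β = 2^{-(log₂ n)^{A+2}}`.
* AGM (hyp. 2) gives a `K`-wise independent `μ'` with `‖ν − μ'‖₁ ≤ 2(βN/W) Σ_{1≤i≤K} C(n-5,i)`;
  Braverman (hyp. 1, at input length `n-5` via `tendsto_sub_atTop_nat`, depth `max k 1`, size
  polynomial `p(X+5)+1`, accuracy `ε/2`; `(log₂ (n-5))^A ≤ K`) gives `|E_{μ'} sgn D − avg sgn D| ≤ ε/2`.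
* ASSEMBLY: `|Σ_Q w sgn C − W avg| ≤ W(‖ν−μ'‖₁ + ε/2) ≤ 2βN·K n^K + εN/2 ≤ εN`, by the numerics
  `4 β K n^K ≤ ε` once `log₂ n ≥ M + 4`, `2^M > 1/ε` (`SubcubeTransfer.numerics`).
-/

set_option linter.dupNamespace false -- D-0017: single-problem summit ⇒ QuantumAdvantage.QuantumAdvantage by design

noncomputable section

namespace Summit.QuantumAdvantage.QuantumAdvantage.Theorems.AcZeroRung

open Filter Finset
open Literature.Computability.Complexity
open Literature.Probability.RandomGraphs.LowDegree
open Literature.Barriers.PneNP (IsDWiseIndependent)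
open SubcubeTransfer

/-- **S3 · stub_subcubeTransfer — from the cube to weighted class sub-cubes.** Braverman (S1)
and AGM (S2) imply: for depth `k`, size `p`, accuracy `ε` there is `A` such that for large `n`,
every NONNEGATIVE weight `w` on the class sub-cube `Q_{n,r} = {2^{n-1} ≤ d < 2^n : d ≡ r (16)}`
of mass `≤ N` whose Walsh sums on nonempty sets of `≤ (log₂ n)^A` free positions
(`4 ≤ i ≤ n − 2`) are `≤ 2^{−(log₂ n)^{A+2}} N` satisfies
`|Σ_Q w·sgn C − (Σ_Q w)·avg_Q sgn C| ≤ ε N` for every depth-`k` size-`p(n)` circuit over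
`acBasis`. Proof: `Q_{n,r} ≅ {0,1}^{n−5}` by the free bits; project `C` onto the free inputs
(`Circuit.exists_project`); AGM on `w/Σw`, Braverman at input length `n − 5`; numerics. -/
theorem stub_subcubeTransfer :
    (∀ (k : ℕ) (p : Polynomial ℕ) (ε : ℝ), 0 < ε → ∃ A : ℕ, ∀ᶠ m : ℕ in Filter.atTop,
      ∀ C : Circuit (Fin m), C.IsOver acBasis → C.acDepth ≤ k → C.size ≤ p.eval m →
      ∀ μ : PMF (Fin m → Bool), IsDWiseIndependent (Nat.log 2 m ^ A) μ →
        |∑ x, (μ x).toReal * sgn (C.eval x) - (∑ x : Fin m → Bool, sgn (C.eval x)) / 2 ^ m| ≤ ε) →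
    (∀ (n K : ℕ) (γ : ℝ) (μ : PMF (Fin n → Bool)), 0 ≤ γ →
      (∀ T : Finset (Fin n), T.Nonempty → T.card ≤ K → |charMean μ T| ≤ γ) →
      ∃ μ' : PMF (Fin n → Bool), IsDWiseIndependent K μ' ∧
        ∑ x, |(μ x).toReal - (μ' x).toReal| ≤ 2 * γ * ∑ i ∈ Finset.Icc 1 K, (n.choose i : ℝ)) →
    ∀ (k : ℕ) (p : Polynomial ℕ) (ε : ℝ), 0 < ε → ∃ A : ℕ, ∀ᶠ n : ℕ in Filter.atTop,
      ∀ (r : ℕ) (N : ℝ) (w : ℕ → ℝ), (∀ d, 0 ≤ w d) →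
      ∑ d ∈ (Finset.Ico (2 ^ (n - 1)) (2 ^ n)).filter (fun d => d % 16 = r), w d ≤ N →
      (∀ S : Finset (Fin n), S.Nonempty → S.card ≤ Nat.log 2 n ^ A →
        (∀ i ∈ S, 4 ≤ (i : ℕ) ∧ (i : ℕ) + 1 < n) →
        |∑ d ∈ (Finset.Ico (2 ^ (n - 1)) (2 ^ n)).filter (fun d => d % 16 = r),
            w d * walsh S (fun i : Fin n => Nat.testBit d i)|
          ≤ (2 : ℝ) ^ (-((Nat.log 2 n : ℝ) ^ (A + 2))) * N) →
      ∀ C : Circuit (Fin n), C.IsOver acBasis → C.acDepth ≤ k → C.size ≤ p.eval n →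
        |∑ d ∈ (Finset.Ico (2 ^ (n - 1)) (2 ^ n)).filter (fun d => d % 16 = r),
            w d * sgn (C.eval (fun i : Fin n => Nat.testBit d i))
          - (∑ d ∈ (Finset.Ico (2 ^ (n - 1)) (2 ^ n)).filter (fun d => d % 16 = r), w d)
            * ((∑ d ∈ (Finset.Ico (2 ^ (n - 1)) (2 ^ n)).filter (fun d => d % 16 = r),
                sgn (C.eval (fun i : Fin n => Nat.testBit d i)))
              / ((((Finset.Ico (2 ^ (n - 1)) (2 ^ n)).filter (fun d => d % 16 = r)).card : ℕ) : ℝ))|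
          ≤ ε * N := by
  intro hBrav hAGM k p ε hε
  obtain ⟨A, hA⟩ := hBrav (max k 1) (p.comp (Polynomial.X + 5) + 1) (ε / 2) (half_pos hε)
  obtain ⟨M, hM⟩ := pow_unbounded_of_one_lt (1 / ε) (one_lt_two (α := ℝ))
  refine ⟨A, ?_⟩
  filter_upwards [eventually_ge_atTop (max 6 (2 ^ (M + 4))),
    (tendsto_sub_atTop_nat 5).eventually hA] with n hn hB
  intro r N w hw hWN hWalsh C hC hdep hsize
  have hn6 : 6 ≤ n := le_of_max_le_left hn
  have hn5 : 5 ≤ n := by omega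
  have hlogM : M + 4 ≤ Nat.log 2 n := by
    rw [Nat.le_log_iff_pow_le one_lt_two (by omega)]
    exact le_of_max_le_right hn
  set Q := (Finset.Ico (2 ^ (n - 1)) (2 ^ n)).filter (fun d => d % 16 = r) with hQ
  set W := ∑ d ∈ Q, w d with hW
  have hW0 : 0 ≤ W := Finset.sum_nonneg fun d _ => hw d
  rcases hW0.eq_or_lt with hW0 | hWpos
  · -- degenerate case: the weight vanishes on `Q`
    have hw0 : ∀ d ∈ Q, w d = 0 :=
      (Finset.sum_eq_zero_iff_of_nonneg (fun d _ => hw d)).1 hW0.symm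
    have h1 : ∑ d ∈ Q, w d * sgn (C.eval (fun i : Fin n => Nat.testBit d i)) = 0 :=
      Finset.sum_eq_zero fun d hd => by rw [hw0 d hd, zero_mul]
    rw [h1, ← hW0, zero_mul, sub_zero, abs_zero]
    exact mul_nonneg hε.le (hW0.le.trans hWN)
  -- main case: `W > 0`, so `Q ≠ ∅` and `r < 16`
  have hNpos : 0 < N := hWpos.trans_le hWN
  obtain ⟨d₀, hd₀⟩ : Q.Nonempty := Finset.nonempty_of_sum_ne_zero hWpos.ne'
  have hr : r < 16 := by
    have := (Finset.mem_filter.1 hd₀).2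
    omega
  -- coordinates on `Q` by the free bits, and the projected circuit on the `n - 5` free inputs
  obtain ⟨enc, ρ, π, hinj, himage, hfree, hrestrict⟩ := exists_coords hn6 hr
  rw [← hQ] at himage
  have hsumQ : ∀ F : ℕ → ℝ, ∑ d ∈ Q, F d = ∑ z : Fin (n - 5) → Bool, F (enc z) := fun F => by
    rw [← himage, Finset.sum_image fun z _ z' _ h => hinj h]
  have hcardQ : Q.card = 2 ^ (n - 5) := by
    rw [← himage, Finset.card_image_of_injective _ hinj, Finset.card_univ, Fintype.card_fun,
      Fintype.card_bool, Fintype.card_fin]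
  obtain ⟨D, hDB, hDs, hDd, hDev⟩ := C.exists_project hC ρ π
  have hDev' : ∀ z : Fin (n - 5) → Bool,
      D.eval z = C.eval (fun i : Fin n => (enc z).testBit i) := fun z => by
    rw [hDev, hrestrict]
  -- the transported, normalised weight as a PMF on the free cube
  obtain ⟨ν, hν⟩ := exists_pmf (fun z : Fin (n - 5) → Bool => w (enc z) / W)
    (fun z => div_nonneg (hw _) hWpos.le)
    (by rw [← Finset.sum_div, ← hsumQ w, div_self hWpos.ne'])
  -- its Walsh biases
  have hbias : ∀ T : Finset (Fin (n - 5)), T.Nonempty → T.card ≤ Nat.log 2 n ^ A →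
      |charMean ν T| ≤ (2 : ℝ) ^ (-((Nat.log 2 n : ℝ) ^ (A + 2))) * N / W := by
    intro T hT hTK
    obtain ⟨S, hSne, hScard, hSfree, hSwalsh⟩ := exists_shift T hT
    have hS := hWalsh S hSne (by rw [hScard]; exact hTK) hSfree
    have hcm : charMean ν T =
        (∑ d ∈ Q, w d * walsh S (fun i : Fin n => Nat.testBit d i)) / W := by
      rw [charMean, hsumQ, Finset.sum_div]
      refine Finset.sum_congr rfl fun z _ => ?_
      rw [hν, hSwalsh]
      have hwz : walsh T (fun j : Fin (n - 5) => (enc z).testBit ((j : ℕ) + 4)) = walsh T z :=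
        congrArg (walsh T) (funext fun j => hfree z j)
      rw [hwz]
      ring
    rw [hcm, abs_div, abs_of_pos hWpos]
    exact div_le_div_of_nonneg_right hS hWpos.le
  -- Alon–Goldreich–Mansour
  obtain ⟨μ', hμ'K, hμ'L1⟩ :=
    hAGM (n - 5) (Nat.log 2 n ^ A) ((2 : ℝ) ^ (-((Nat.log 2 n : ℝ) ^ (A + 2))) * N / W) ν
      (by positivity) hbias
  -- Braverman at input length `n - 5`
  have hμ'ind : IsDWiseIndependent (Nat.log 2 (n - 5) ^ A) μ' :=
    hμ'K.of_le (Nat.pow_le_pow_left (Nat.log_mono_right (Nat.sub_le n 5)) A)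
  have hDsize : D.size ≤ (p.comp (Polynomial.X + 5) + 1).eval (n - 5) := by
    have h5 : n - 5 + 5 = n := Nat.sub_add_cancel hn5
    have : (p.comp (Polynomial.X + 5) + 1).eval (n - 5) = p.eval n + 1 := by
      simp [Polynomial.eval_comp, h5]
    rw [this]
    exact hDs.trans (max_le (hsize.trans (Nat.le_succ _)) (by omega))
  have hfool := hB D hDB (hDd.trans (max_le_max hdep le_rfl)) hDsize μ' hμ'ind
  -- all `Q`-sums as sums over the free cube
  have hsum1 : ∑ d ∈ Q, w d * sgn (C.eval (fun i : Fin n => Nat.testBit d i)) =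
      W * ∑ z : Fin (n - 5) → Bool, (ν z).toReal * sgn (D.eval z) := by
    rw [hsumQ, Finset.mul_sum]
    refine Finset.sum_congr rfl fun z _ => ?_
    rw [hν, hDev']
    field_simp
  have hsum2 : ∑ d ∈ Q, sgn (C.eval (fun i : Fin n => Nat.testBit d i)) =
      ∑ z : Fin (n - 5) → Bool, sgn (D.eval z) := by
    rw [hsumQ]
    exact Finset.sum_congr rfl fun z _ => by rw [hDev']
  have hcard : ((Q.card : ℕ) : ℝ) = 2 ^ (n - 5) := by
    rw [hcardQ, Nat.cast_pow, Nat.cast_ofNat]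
  rw [hsum1, hsum2, hcard]
  have hL1 : |∑ z : Fin (n - 5) → Bool, (ν z).toReal * sgn (D.eval z) -
      ∑ z : Fin (n - 5) → Bool, (μ' z).toReal * sgn (D.eval z)| ≤
      ∑ z : Fin (n - 5) → Bool, |(ν z).toReal - (μ' z).toReal| := by
    rw [← Finset.sum_sub_distrib]
    refine (Finset.abs_sum_le_sum_abs _ _).trans (Finset.sum_le_sum fun z _ => ?_)
    rw [← sub_mul, abs_mul]
    refine mul_le_of_le_one_right (abs_nonneg _) ?_
    cases D.eval z <;> simp [sgn]
  -- numerics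
  have hchoose : ∑ i ∈ Finset.Icc 1 (Nat.log 2 n ^ A), ((n - 5).choose i : ℝ) ≤
      (Nat.log 2 n ^ A : ℕ) * (n : ℝ) ^ (Nat.log 2 n ^ A) := by
    have h1 : ∀ i ∈ Finset.Icc 1 (Nat.log 2 n ^ A),
        ((n - 5).choose i : ℝ) ≤ (n : ℝ) ^ (Nat.log 2 n ^ A) := by
      intro i hi
      rw [Finset.mem_Icc] at hi
      have : (n - 5).choose i ≤ n ^ (Nat.log 2 n ^ A) :=
        (Nat.choose_le_pow _ i).trans ((Nat.pow_le_pow_left (Nat.sub_le n 5) i).trans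
          (Nat.pow_le_pow_right (by omega) hi.2))
      exact_mod_cast this
    refine (Finset.sum_le_sum h1).trans ?_
    rw [Finset.sum_const, Nat.card_Icc, Nat.add_sub_cancel, nsmul_eq_mul]
  have hP := numerics A M (Nat.lt_pow_succ_log_self one_lt_two n) hlogM
  have hP' : (4 * ((Nat.log 2 n ^ A : ℕ) * (n : ℝ) ^ (Nat.log 2 n ^ A)) * 2 ^ M : ℝ) ≤
      2 ^ (Nat.log 2 n ^ (A + 2)) := by exact_mod_cast hP
  have hβ : (2 : ℝ) ^ (-((Nat.log 2 n : ℝ) ^ (A + 2))) = ((2 : ℝ) ^ (Nat.log 2 n ^ (A + 2)))⁻¹ := by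
    rw [Real.rpow_neg (by norm_num), ← Nat.cast_pow, Real.rpow_natCast]
  have hε2 : 1 ≤ ε * 2 ^ M := by
    have := (div_lt_iff₀ hε).1 hM
    linarith
  have hnum : 4 * (2 : ℝ) ^ (-((Nat.log 2 n : ℝ) ^ (A + 2))) *
      ((Nat.log 2 n ^ A : ℕ) * (n : ℝ) ^ (Nat.log 2 n ^ A)) ≤ ε := by
    rw [hβ]
    have h2P : (0 : ℝ) < (2 : ℝ) ^ (Nat.log 2 n ^ (A + 2)) := by positivity
    set X : ℝ := (Nat.log 2 n ^ A : ℕ) * (n : ℝ) ^ (Nat.log 2 n ^ A) with hX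
    have hX0 : 0 ≤ X := by positivity
    calc 4 * ((2 : ℝ) ^ (Nat.log 2 n ^ (A + 2)))⁻¹ * X
        = 4 * X / (2 : ℝ) ^ (Nat.log 2 n ^ (A + 2)) := by ring
      _ ≤ 4 * X * (ε * 2 ^ M) / (2 : ℝ) ^ (Nat.log 2 n ^ (A + 2)) :=
          div_le_div_of_nonneg_right (le_mul_of_one_le_right (by positivity) hε2) h2P.le
      _ = ε * (4 * X * 2 ^ M / (2 : ℝ) ^ (Nat.log 2 n ^ (A + 2))) := by ring
      _ ≤ ε * 1 := by
          gcongr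
          rw [div_le_one h2P]
          exact hP'
      _ = ε := mul_one ε
  -- assembly
  set β : ℝ := (2 : ℝ) ^ (-((Nat.log 2 n : ℝ) ^ (A + 2))) with hβdef
  set X : ℝ := ((Nat.log 2 n ^ A : ℕ) : ℝ) * (n : ℝ) ^ (Nat.log 2 n ^ A) with hXdef
  have hL1' : ∑ z : Fin (n - 5) → Bool, |(ν z).toReal - (μ' z).toReal| ≤ 2 * (β * N / W) * X :=
    hμ'L1.trans (mul_le_mul_of_nonneg_left hchoose (by positivity))
  set Sν := ∑ z : Fin (n - 5) → Bool, (ν z).toReal * sgn (D.eval z) with hSν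
  set Sμ := ∑ z : Fin (n - 5) → Bool, (μ' z).toReal * sgn (D.eval z) with hSμ
  set Sg := ∑ z : Fin (n - 5) → Bool, sgn (D.eval z) with hSg
  have key : |Sν - Sg / 2 ^ (n - 5)| ≤ 2 * (β * N / W) * X + ε / 2 := by
    have := abs_sub_le Sν Sμ (Sg / 2 ^ (n - 5))
    linarith
  rw [← mul_sub, abs_mul, abs_of_pos hWpos]
  have h1 : 2 * β * X ≤ ε / 2 := by linarith [hnum]
  calc W * |Sν - Sg / 2 ^ (n - 5)|
      ≤ W * (2 * (β * N / W) * X + ε / 2) := mul_le_mul_of_nonneg_left key hWpos.le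
    _ = 2 * β * X * N * (W * W⁻¹) + W * (ε / 2) := by rw [div_eq_mul_inv]; ring
    _ = 2 * β * X * N + W * (ε / 2) := by rw [mul_inv_cancel₀ hWpos.ne', mul_one]
    _ ≤ ε / 2 * N + N * (ε / 2) :=
        add_le_add (mul_le_mul_of_nonneg_right h1 hNpos.le)
          (mul_le_mul_of_nonneg_right hWN (by positivity))
    _ = ε * N := by ring

end Summit.QuantumAdvantage.QuantumAdvantage.Theorems.AcZeroRung

end
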